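import Summits.BirchSwinnertonDyer.BirchSwinnertonDyer.Theorems.KolyvaginDepthDoorDepthTableKurihara
import Summits.BirchSwinnertonDyer.BirchSwinnertonDyer.Theorems.KolyvaginDepthDoorDepthTableSteinWuthrichRows5
import Summits.BirchSwinnertonDyer.BirchSwinnertonDyer.Theorems.KolyvaginDepthDoorDepthTableSteinWuthrichRows10
import Summits.BirchSwinnertonDyer.BirchSwinnertonDyer.Theorems.KolyvaginDepthDoorDepthTableSteinWuthrichRows11
import Summits.BirchSwinnertonDyer.BirchSwinnertonDyer.Theorems.KolyvaginDepthDoorDepthTableRankTwo817a1TwistBSDQuotientUniform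
import Summits.BirchSwinnertonDyer.BirchSwinnertonDyer.Theorems.KolyvaginDepthDoorDepthTableRowsIntrinsic5
import Summits.BirchSwinnertonDyer.Rank1Residual.Supersingular.CountPointsFast
import Summits.BirchSwinnertonDyer.Rank1Residual.Additive.X4ThreeKuriharaCertKernel
import HarnessLib

/-!
# Route `KolyvaginDepthDoor`, crux `KolyvaginDepthSupplyKN` (stmt-BirchSwinnertonDyer-22820) —
# DEPTH TABLE v17, E-SIDE TABLE at `p = 5` (part 2: `817a1`, `916c1`, `944e1`): `Ш(E/ℚ)[5] = 0` from the TREE'S OWN Kurihara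
# records (Kim 2026 Thm. 1.11 by name) — the `E`-side input of every v13–v16 row WITHOUT Stein–Wuthrich

Helper file of the lead prover of line `levelone` (kdd-p1 g21; `--supports stmt-BirchSwinnertonDyer-22820
--as helper`); it closes nothing and BSD is NOT proved by it.

Every row of the depth table v13–v16 carries the conjunct «`Ш(E/ℚ)[p] = 0`» of the rank-two curve as Stein–Wuthrich
2013 Thm. 1.1 BY NAME (a computational theorem: 1 534 422 pairs verified by the authors' code). The v17 generic
`sha_inf_torsionBy_eq_bot_of_kuriharaClaim` (`KolyvaginDepthDoorDepthTableKurihara`) reads the same conjunct off ONE unit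
mod-`p` Kurihara number at a cyclic level of depth `2 ≤ rank E` via Kim 2026 Thm. 1.11 — and for the table's curves such
numbers are ALREADY IN THE TREE as kernel-rechecked records (`Literature/NumberTheory/EllipticCurves/KuriharaCertificates/`,
fleet jobs, PARI `msfromell`, symbol-table hashes pinned). This file instantiates it for the six curves of the table at
which `p = 5` is admissible for Kim's theorem (good ordinary, `ρ̄_{E,5}` onto, NON-ANOMALOUS `a_5 ≢ 1`) AND the record's
level has cyclic `5`-parts (`25 ∤ #Ẽ(𝔽_ℓ)`):

* `571b1` = `[0, 1, 1, -4, 2]`: record `(5, 11·41 = 451, 2, 3)` (`RecordsN000550to000580`); `#Ẽ(𝔽_11) = 15`, `#Ẽ(𝔽_41) = 40`, `a_5 = -2`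
* `643a1` = `[1, 0, 0, -4, 3]`: record `(5, 31·41 = 1271, 2, 4)` (`RecordsN000615to000650`); `#Ẽ(𝔽_31) = 35`, `#Ẽ(𝔽_41) = 40`, `a_5 = -2`
* `709a1` = `[0, -1, 1, -2, 0]`: record `(5, 71·101 = 7171, 2, 4)` (`RecordsN000688to000715`); `#Ẽ(𝔽_71) = 80`, `#Ẽ(𝔽_101) = 110`, `a_5 = -3`
* `817a1` = `[0, 1, 1, 1, 6]`: record `(5, 31·401 = 12431, 2, 4)` (`RecordsN000816to000849`); `#Ẽ(𝔽_31) = 35`, `#Ẽ(𝔽_401) = 415`, `a_5 = -2`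
* `916c1` = `[0, 0, 0, -4, 1]`: record `(5, 11·31 = 341, 2, 1)` (`RecordsN000905to000928`); `#Ẽ(𝔽_11) = 15`, `#Ẽ(𝔽_31) = 30`, `a_5 = -3`
* `944e1` = `[0, 0, 0, -19, 34]`: record `(5, 31·191 = 5921, 2, 3)` (`RecordsN000930to000957`); `#Ẽ(𝔽_31) = 30`, `#Ẽ(𝔽_191) = 190`, `a_5 = -3`

(`389a1` is in `KolyvaginDepthDoorDepthTableKuriharaRow389a1`; `433a1, 446d1, 563a1, 664a1, 681c1, 794a1, 997b1` are
ANOMALOUS at `5` (`a_5 = −4`) and `655a1, 707a1, 718b1, 997c1` have a non-cyclic level prime at `5` — their records at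
`p ∈ {7, 11, 13}` serve instead, sequel file.) Per curve the kernel decides the two point counts (`countPointsFast`),
the Kolyvagin conditions `ℓ ≡ 1`, `a_ℓ ≡ 2 (mod 5)`, cyclicity, and `a_5 ≢ 1`; `5` good ordinary, `ρ̄_{E,5}` onto,
Kodaira–Néron at `5` and `2 ≤ rank_ℤ E(ℚ)` are the lineage's kernel theorems. RESULT per curve
(`C<label>.sha_inf_torsionBy_five_eq_bot_of_kuriharaClaim`): `Ш(E/ℚ)[5] = 0` — hence `corank_{ℤ₅} Ш(E)[5^∞] = 0`, X1 at
`5` for the curve — CONDITIONAL on Kim 2026 Thm. 1.11 (`hKim`), modularity (`hnf`), Mazur 1978 Cor. 4.1 (`hMaz`) BY NAME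
and on the record's CLAIM (`hδ`, read at level `N_E` through `KuriharaCertificates.Record.Claim`). Substituting it for
`C<label>.sha_inf_torsionBy_five_eq_bot hSW` in any v13–v16 row removes Stein–Wuthrich from that row. Per curve; nothing
class-wide; BSD is NOT proved by any of this.

References: [Kim2022StructureSelmer] Thm. 1.11, §1.2.2; [Mazur1978] Cor. 4.1; [CremonaAlgorithms1997] Table 1;
[SilvermanAEC2009] VII.3.1, X.4.2; [SteinWuthrich2013] Thm. 1.1 (the input replaced).
-/

set_option linter.dupNamespace false

noncomputable section

open scoped Classical NumberField

namespace Summit.BirchSwinnertonDyer.BirchSwinnertonDyer.Theorems.KolyvaginDepthDoor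

open Literature.NumberTheory.EllipticCurves Literature.NumberTheory.EllipticCurves.ModularForms
  WeierstrassCurve NumberField IsDedekindDomain
open Summit.BirchSwinnertonDyer.BirchSwinnertonDyer.Theorems
open Summit.BirchSwinnertonDyer.BirchSwinnertonDyer.Rank2Observatory
open Summit.BirchSwinnertonDyer.BirchSwinnertonDyer.Rank1Residual (IntModel.frobeniusTrace_eq)
open Summit.BirchSwinnertonDyer.Rank1Residual.Supersingular (natCard_point_eq_of_countPoints countPoints_eq_of_fast)
open Summit.BirchSwinnertonDyer.Rank1Residual.Additive (card_torsion_le_of_intModel_of_card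
  isKolyvaginPrime_of_intModel_of_card isKolyvaginProduct_mul)


/-! ## `817a1` = `[0, 1, 1, 1, 6]`: record `cert_817a1` @ `(5, 31·401)`, `δ̃ ≡ 4` -/

namespace C817a1

/-- `#Ẽ(𝔽_31) = 35` for `817a1` (`31 ≡ 1`, `a_31 = -3 ≡ 2 (mod 5)`, `25 ∤ 35`), kernel-decided (`countPointsFast`). [cite: CremonaAlgorithms1997, Table 1 (817a1)] -/
theorem card_31 :
    Nat.card (((⟨0, 1, 1, 1, 6⟩ : WeierstrassCurve ℤ).map (Int.castRingHom (ZMod 31))).toAffine.Point) = 35 :=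
  haveI : Fact (Nat.Prime 31) := ⟨by norm_num⟩
  natCard_point_eq_of_countPoints 0 1 1 1 6 31 (by norm_num) (by decide +kernel) (n := 35)
    (countPoints_eq_of_fast (by decide +kernel))

/-- `#Ẽ(𝔽_401) = 415` for `817a1` (`401 ≡ 1`, `a_401 = -13 ≡ 2 (mod 5)`, `25 ∤ 415`), kernel-decided (`countPointsFast`). [cite: CremonaAlgorithms1997, Table 1 (817a1)] -/
theorem card_401 :
    Nat.card (((⟨0, 1, 1, 1, 6⟩ : WeierstrassCurve ℤ).map (Int.castRingHom (ZMod 401))).toAffine.Point) = 415 :=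
  haveI : Fact (Nat.Prime 401) := ⟨by norm_num⟩
  natCard_point_eq_of_countPoints 0 1 1 1 6 401 (by norm_num) (by decide +kernel) (n := 415)
    (countPoints_eq_of_fast (by decide +kernel))

/-- **`12431 = 31·401` is a cyclic Kolyvagin level for `(817a1, 5)`** — the level of the tree record `cert_817a1` at `p = 5`.
[cite: Kim2022StructureSelmer, §1.2.2 (PDF p. 5)] -/
theorem isCyclicKolyvaginLevel_5_12431 :
    haveI := isGloballyMinimal_c817a1; haveI := Fact.mk (by norm_num : Nat.Prime 5);
    IsCyclicKolyvaginLevel ((⟨0, 1, 1, 1, 6⟩ : WeierstrassCurve ℤ).map (Int.castRingHom ℚ)) 5 12431 := by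
  haveI := isElliptic_c817a1
  haveI := isGloballyMinimal_c817a1
  haveI := Fact.mk (by norm_num : Nat.Prime 5)
  haveI : Fact (Nat.Prime 31) := ⟨by norm_num⟩
  haveI : Fact (Nat.Prime 401) := ⟨by norm_num⟩
  have h₁ : Kato.IsKolyvaginPrime ((⟨0, 1, 1, 1, 6⟩ : WeierstrassCurve ℤ).map (Int.castRingHom ℚ)) 5 1 31 :=
    isKolyvaginPrime_of_intModel_of_card intModel 5 1 31 (by norm_num) (by decide +kernel) (by decide) card_31
      (by norm_num)
  have h₂ : Kato.IsKolyvaginPrime ((⟨0, 1, 1, 1, 6⟩ : WeierstrassCurve ℤ).map (Int.castRingHom ℚ)) 5 1 401 :=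
    isKolyvaginPrime_of_intModel_of_card intModel 5 1 401 (by norm_num) (by decide +kernel) (by decide) card_401
      (by norm_num)
  refine ⟨by simpa using isKolyvaginProduct_mul h₁ h₂ (by norm_num), fun ℓ hℓ hdvd ↦ ?_⟩
  rw [show (12431 : ℕ) = 31 * 401 from rfl] at hdvd
  rcases (Nat.Prime.dvd_mul hℓ.out).mp hdvd with h | h
  · obtain rfl := (Nat.prime_dvd_prime_iff_eq hℓ.out (by norm_num)).mp h
    exact card_torsion_le_of_intModel_of_card intModel 5 31 card_31 (by norm_num)
  · obtain rfl := (Nat.prime_dvd_prime_iff_eq hℓ.out (by norm_num)).mp h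
    exact card_torsion_le_of_intModel_of_card intModel 5 401 card_401 (by norm_num)

/-- **`5` is non-anomalous for `817a1`**: `a_5 = 6 − 8 = -2`, `5 ∤ a_5 − 1`. [cite: SilvermanAEC2009, VII.3 Prop. 3.1] -/
theorem nonAnomalous_5 :
    haveI := isGloballyMinimal_c817a1; haveI := Fact.mk (by norm_num : Nat.Prime 5);
    ¬ ((5 : ℕ) : ℤ) ∣ ((⟨0, 1, 1, 1, 6⟩ : WeierstrassCurve ℤ).map (Int.castRingHom ℚ)).frobeniusTrace 5 - 1 := by
  haveI := isElliptic_c817a1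
  haveI := isGloballyMinimal_c817a1
  haveI := Fact.mk (by norm_num : Nat.Prime 5)
  rw [IntModel.frobeniusTrace_eq intModel card_5]
  decide

/-- **`Ш(817a1/ℚ)[5] = 0` FROM THE TREE RECORD `cert_817a1` @ `(5, 31·401)`** (Kurihara currency; replaces the Stein–Wuthrich
input `sha_inf_torsionBy_five_eq_bot hSW` of the v13–v16 rows of this curve): granted Kim 2026 Thm. 1.11 (`hKim`), modularity
(`hnf`), Mazur 1978 Cor. 4.1 (`hMaz`) BY NAME and the record's CLAIM `hδ` (read at level `N_E` through
`KuriharaCertificates.Record.Claim`), `#Sel_5(E/ℚ) ≤ 5² = 5^rank` and so `Ш(E/ℚ)[5] = 0` (`5` good ordinary `goodOrdinary_5`,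
`ρ̄_{E,5}` onto `hasSurjectiveModNGaloisRep_pow_5 1`, `nonAnomalous_5`, Kodaira–Néron `kodairaNeron_of_five_le 5`, `2 ≤ rank`
`KernelCertsR01.C817a1.two_le_rank`). CONDITIONAL on the three named facts and the claim; per curve; BSD is not proved by it.
[cite: Kim2022StructureSelmer, Thm. 1.11 (PDF p. 8)] [cite: Mazur1978, Cor. 4.1] [cite: CremonaAlgorithms1997, Table 1 (817a1)] -/
theorem sha_inf_torsionBy_five_eq_bot_of_kuriharaClaim
    (hKim : Kim2022_card_selmerGroup_le_pow_of_kuriharaNumber_ne_zero)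
    (hnf : exists_isNewformOf) (hMaz : mazur_not_dvd_maninConstant_of_odd)
    (hδ : haveI := isElliptic_c817a1; haveI := isGloballyMinimal_c817a1;
      haveI : NeZero (((⟨0, 1, 1, 1, 6⟩ : WeierstrassCurve ℤ).map (Int.castRingHom ℚ)).conductorNorm ℤ) := neZero_conductorNorm_of_isElliptic _;
      haveI := Fact.mk (by norm_num : Nat.Prime 5);
      ∀ (D : ModularParametrizationData ((⟨0, 1, 1, 1, 6⟩ : WeierstrassCurve ℤ).map (Int.castRingHom ℚ)) (((⟨0, 1, 1, 1, 6⟩ : WeierstrassCurve ℤ).map (Int.castRingHom ℚ)).conductorNorm ℤ)), ¬ ((5 : ℕ) : ℤ) ∣ D.maninConstant →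
        (∃ u : ℚ, ‖(u : ℚ_[5])‖ = 1 ∧ ((⟨0, 1, 1, 1, 6⟩ : WeierstrassCurve ℤ).map (Int.castRingHom ℚ)).realPeriodRat = u * plusPeriod D.f) →
        ∃ ψ : (ℓ : ℕ) → (ZMod ℓ)ˣ →* Multiplicative (ZMod 5),
          (∀ ℓ ∈ (12431 : ℕ).primeFactors, Function.Surjective (ψ ℓ)) ∧ kuriharaNumber D.f 5 12431 ψ ≠ 0) :
    haveI := isElliptic_c817a1; haveI := isGloballyMinimal_c817a1; haveI := Fact.mk (by norm_num : Nat.Prime 5);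
    (((⟨0, 1, 1, 1, 6⟩ : WeierstrassCurve ℤ).map (Int.castRingHom ℚ)).sha ⊓ AddSubgroup.torsionBy ((⟨0, 1, 1, 1, 6⟩ : WeierstrassCurve ℤ).map (Int.castRingHom ℚ)).galH1 ((5 : ℕ) : ℤ) : AddSubgroup _) = ⊥ := by
  haveI := isElliptic_c817a1
  haveI := isGloballyMinimal_c817a1
  haveI iNZ : NeZero (((⟨0, 1, 1, 1, 6⟩ : WeierstrassCurve ℤ).map (Int.castRingHom ℚ)).conductorNorm ℤ) := neZero_conductorNorm_of_isElliptic _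
  haveI := Fact.mk (by norm_num : Nat.Prime 5)
  haveI : NeZero (12431 : ℕ) := ⟨by norm_num⟩
  have hsur : ((⟨0, 1, 1, 1, 6⟩ : WeierstrassCurve ℤ).map (Int.castRingHom ℚ)).HasSurjectiveModNGaloisRep (5 ^ 1 : ℕ) := hasSurjectiveModNGaloisRep_pow_5 1
  rw [pow_one] at hsur
  have hν : (12431 : ℕ).primeFactors.card ≤ ((⟨0, 1, 1, 1, 6⟩ : WeierstrassCurve ℤ).map (Int.castRingHom ℚ)).mordellWeilRank := by
    refine le_trans (le_of_eq ?_) KernelCertsR01.C817a1.two_le_rank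
    rw [show (12431 : ℕ) = 31 * 401 from rfl, Nat.primeFactors_mul (by norm_num) (by norm_num),
      Nat.Prime.primeFactors (by norm_num), Nat.Prime.primeFactors (by norm_num)]
    decide
  exact sha_inf_torsionBy_eq_bot_of_kuriharaClaim hKim hnf hMaz _ 5 le_rfl goodOrdinary_5.1 goodOrdinary_5.2 hsur
    nonAnomalous_5 (kodairaNeron_of_five_le 5 le_rfl) 12431 isCyclicKolyvaginLevel_5_12431 hν hδ

end C817a1


/-! ## `916c1` = `[0, 0, 0, -4, 1]`: record `cert_916c1` @ `(5, 11·31)`, `δ̃ ≡ 1` -/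

namespace C916c1

/-- `#Ẽ(𝔽_11) = 15` for `916c1` (`11 ≡ 1`, `a_11 = -3 ≡ 2 (mod 5)`, `25 ∤ 15`), kernel-decided (`countPointsFast`). [cite: CremonaAlgorithms1997, Table 1 (916c1)] -/
theorem card_11 :
    Nat.card (((⟨0, 0, 0, -4, 1⟩ : WeierstrassCurve ℤ).map (Int.castRingHom (ZMod 11))).toAffine.Point) = 15 :=
  haveI : Fact (Nat.Prime 11) := ⟨by norm_num⟩
  natCard_point_eq_of_countPoints 0 0 0 (-4) 1 11 (by norm_num) (by decide +kernel) (n := 15)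
    (countPoints_eq_of_fast (by decide +kernel))

/-- `#Ẽ(𝔽_31) = 30` for `916c1` (`31 ≡ 1`, `a_31 = 2 ≡ 2 (mod 5)`, `25 ∤ 30`), kernel-decided (`countPointsFast`). [cite: CremonaAlgorithms1997, Table 1 (916c1)] -/
theorem card_31 :
    Nat.card (((⟨0, 0, 0, -4, 1⟩ : WeierstrassCurve ℤ).map (Int.castRingHom (ZMod 31))).toAffine.Point) = 30 :=
  haveI : Fact (Nat.Prime 31) := ⟨by norm_num⟩
  natCard_point_eq_of_countPoints 0 0 0 (-4) 1 31 (by norm_num) (by decide +kernel) (n := 30)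
    (countPoints_eq_of_fast (by decide +kernel))

/-- **`341 = 11·31` is a cyclic Kolyvagin level for `(916c1, 5)`** — the level of the tree record `cert_916c1` at `p = 5`.
[cite: Kim2022StructureSelmer, §1.2.2 (PDF p. 5)] -/
theorem isCyclicKolyvaginLevel_5_341 :
    haveI := isGloballyMinimal_c916c1; haveI := Fact.mk (by norm_num : Nat.Prime 5);
    IsCyclicKolyvaginLevel ((⟨0, 0, 0, -4, 1⟩ : WeierstrassCurve ℤ).map (Int.castRingHom ℚ)) 5 341 := by
  haveI := isElliptic_c916c1
  haveI := isGloballyMinimal_c916c1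
  haveI := Fact.mk (by norm_num : Nat.Prime 5)
  haveI : Fact (Nat.Prime 11) := ⟨by norm_num⟩
  haveI : Fact (Nat.Prime 31) := ⟨by norm_num⟩
  have h₁ : Kato.IsKolyvaginPrime ((⟨0, 0, 0, -4, 1⟩ : WeierstrassCurve ℤ).map (Int.castRingHom ℚ)) 5 1 11 :=
    isKolyvaginPrime_of_intModel_of_card intModel 5 1 11 (by norm_num) (by decide +kernel) (by decide) card_11
      (by norm_num)
  have h₂ : Kato.IsKolyvaginPrime ((⟨0, 0, 0, -4, 1⟩ : WeierstrassCurve ℤ).map (Int.castRingHom ℚ)) 5 1 31 :=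
    isKolyvaginPrime_of_intModel_of_card intModel 5 1 31 (by norm_num) (by decide +kernel) (by decide) card_31
      (by norm_num)
  refine ⟨by simpa using isKolyvaginProduct_mul h₁ h₂ (by norm_num), fun ℓ hℓ hdvd ↦ ?_⟩
  rw [show (341 : ℕ) = 11 * 31 from rfl] at hdvd
  rcases (Nat.Prime.dvd_mul hℓ.out).mp hdvd with h | h
  · obtain rfl := (Nat.prime_dvd_prime_iff_eq hℓ.out (by norm_num)).mp h
    exact card_torsion_le_of_intModel_of_card intModel 5 11 card_11 (by norm_num)
  · obtain rfl := (Nat.prime_dvd_prime_iff_eq hℓ.out (by norm_num)).mp h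
    exact card_torsion_le_of_intModel_of_card intModel 5 31 card_31 (by norm_num)

/-- **`5` is non-anomalous for `916c1`**: `a_5 = 6 − 9 = -3`, `5 ∤ a_5 − 1`. [cite: SilvermanAEC2009, VII.3 Prop. 3.1] -/
theorem nonAnomalous_5 :
    haveI := isGloballyMinimal_c916c1; haveI := Fact.mk (by norm_num : Nat.Prime 5);
    ¬ ((5 : ℕ) : ℤ) ∣ ((⟨0, 0, 0, -4, 1⟩ : WeierstrassCurve ℤ).map (Int.castRingHom ℚ)).frobeniusTrace 5 - 1 := by
  haveI := isElliptic_c916c1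
  haveI := isGloballyMinimal_c916c1
  haveI := Fact.mk (by norm_num : Nat.Prime 5)
  rw [IntModel.frobeniusTrace_eq intModel card_5]
  decide

/-- **`Ш(916c1/ℚ)[5] = 0` FROM THE TREE RECORD `cert_916c1` @ `(5, 11·31)`** (Kurihara currency; replaces the Stein–Wuthrich
input `sha_inf_torsionBy_five_eq_bot hSW` of the v13–v16 rows of this curve): granted Kim 2026 Thm. 1.11 (`hKim`), modularity
(`hnf`), Mazur 1978 Cor. 4.1 (`hMaz`) BY NAME and the record's CLAIM `hδ` (read at level `N_E` through
`KuriharaCertificates.Record.Claim`), `#Sel_5(E/ℚ) ≤ 5² = 5^rank` and so `Ш(E/ℚ)[5] = 0` (`5` good ordinary `goodOrdinary_5`,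
`ρ̄_{E,5}` onto `hasSurjectiveModNGaloisRep_pow_5 1`, `nonAnomalous_5`, Kodaira–Néron `kodairaNeron_of_five_le 5`, `2 ≤ rank`
`KernelCerts002.C916c1.two_le_rank`). CONDITIONAL on the three named facts and the claim; per curve; BSD is not proved by it.
[cite: Kim2022StructureSelmer, Thm. 1.11 (PDF p. 8)] [cite: Mazur1978, Cor. 4.1] [cite: CremonaAlgorithms1997, Table 1 (916c1)] -/
theorem sha_inf_torsionBy_five_eq_bot_of_kuriharaClaim
    (hKim : Kim2022_card_selmerGroup_le_pow_of_kuriharaNumber_ne_zero)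
    (hnf : exists_isNewformOf) (hMaz : mazur_not_dvd_maninConstant_of_odd)
    (hδ : haveI := isElliptic_c916c1; haveI := isGloballyMinimal_c916c1;
      haveI : NeZero (((⟨0, 0, 0, -4, 1⟩ : WeierstrassCurve ℤ).map (Int.castRingHom ℚ)).conductorNorm ℤ) := neZero_conductorNorm_of_isElliptic _;
      haveI := Fact.mk (by norm_num : Nat.Prime 5);
      ∀ (D : ModularParametrizationData ((⟨0, 0, 0, -4, 1⟩ : WeierstrassCurve ℤ).map (Int.castRingHom ℚ)) (((⟨0, 0, 0, -4, 1⟩ : WeierstrassCurve ℤ).map (Int.castRingHom ℚ)).conductorNorm ℤ)), ¬ ((5 : ℕ) : ℤ) ∣ D.maninConstant →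
        (∃ u : ℚ, ‖(u : ℚ_[5])‖ = 1 ∧ ((⟨0, 0, 0, -4, 1⟩ : WeierstrassCurve ℤ).map (Int.castRingHom ℚ)).realPeriodRat = u * plusPeriod D.f) →
        ∃ ψ : (ℓ : ℕ) → (ZMod ℓ)ˣ →* Multiplicative (ZMod 5),
          (∀ ℓ ∈ (341 : ℕ).primeFactors, Function.Surjective (ψ ℓ)) ∧ kuriharaNumber D.f 5 341 ψ ≠ 0) :
    haveI := isElliptic_c916c1; haveI := isGloballyMinimal_c916c1; haveI := Fact.mk (by norm_num : Nat.Prime 5);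
    (((⟨0, 0, 0, -4, 1⟩ : WeierstrassCurve ℤ).map (Int.castRingHom ℚ)).sha ⊓ AddSubgroup.torsionBy ((⟨0, 0, 0, -4, 1⟩ : WeierstrassCurve ℤ).map (Int.castRingHom ℚ)).galH1 ((5 : ℕ) : ℤ) : AddSubgroup _) = ⊥ := by
  haveI := isElliptic_c916c1
  haveI := isGloballyMinimal_c916c1
  haveI iNZ : NeZero (((⟨0, 0, 0, -4, 1⟩ : WeierstrassCurve ℤ).map (Int.castRingHom ℚ)).conductorNorm ℤ) := neZero_conductorNorm_of_isElliptic _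
  haveI := Fact.mk (by norm_num : Nat.Prime 5)
  haveI : NeZero (341 : ℕ) := ⟨by norm_num⟩
  have hsur : ((⟨0, 0, 0, -4, 1⟩ : WeierstrassCurve ℤ).map (Int.castRingHom ℚ)).HasSurjectiveModNGaloisRep (5 ^ 1 : ℕ) := hasSurjectiveModNGaloisRep_pow_5 1
  rw [pow_one] at hsur
  have hν : (341 : ℕ).primeFactors.card ≤ ((⟨0, 0, 0, -4, 1⟩ : WeierstrassCurve ℤ).map (Int.castRingHom ℚ)).mordellWeilRank := by
    refine le_trans (le_of_eq ?_) KernelCerts002.C916c1.two_le_rank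
    rw [show (341 : ℕ) = 11 * 31 from rfl, Nat.primeFactors_mul (by norm_num) (by norm_num),
      Nat.Prime.primeFactors (by norm_num), Nat.Prime.primeFactors (by norm_num)]
    decide
  exact sha_inf_torsionBy_eq_bot_of_kuriharaClaim hKim hnf hMaz _ 5 le_rfl goodOrdinary_5.1 goodOrdinary_5.2 hsur
    nonAnomalous_5 (kodairaNeron_of_five_le 5 le_rfl) 341 isCyclicKolyvaginLevel_5_341 hν hδ

end C916c1


/-! ## `944e1` = `[0, 0, 0, -19, 34]`: record `cert_944e1` @ `(5, 31·191)`, `δ̃ ≡ 3` -/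

namespace C944e1

/-- `#Ẽ(𝔽_31) = 30` for `944e1` (`31 ≡ 1`, `a_31 = 2 ≡ 2 (mod 5)`, `25 ∤ 30`), kernel-decided (`countPointsFast`). [cite: CremonaAlgorithms1997, Table 1 (944e1)] -/
theorem card_31 :
    Nat.card (((⟨0, 0, 0, -19, 34⟩ : WeierstrassCurve ℤ).map (Int.castRingHom (ZMod 31))).toAffine.Point) = 30 :=
  haveI : Fact (Nat.Prime 31) := ⟨by norm_num⟩
  natCard_point_eq_of_countPoints 0 0 0 (-19) 34 31 (by norm_num) (by decide +kernel) (n := 30)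
    (countPoints_eq_of_fast (by decide +kernel))

/-- `#Ẽ(𝔽_191) = 190` for `944e1` (`191 ≡ 1`, `a_191 = 2 ≡ 2 (mod 5)`, `25 ∤ 190`), kernel-decided (`countPointsFast`). [cite: CremonaAlgorithms1997, Table 1 (944e1)] -/
theorem card_191 :
    Nat.card (((⟨0, 0, 0, -19, 34⟩ : WeierstrassCurve ℤ).map (Int.castRingHom (ZMod 191))).toAffine.Point) = 190 :=
  haveI : Fact (Nat.Prime 191) := ⟨by norm_num⟩
  natCard_point_eq_of_countPoints 0 0 0 (-19) 34 191 (by norm_num) (by decide +kernel) (n := 190)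
    (countPoints_eq_of_fast (by decide +kernel))

/-- **`5921 = 31·191` is a cyclic Kolyvagin level for `(944e1, 5)`** — the level of the tree record `cert_944e1` at `p = 5`.
[cite: Kim2022StructureSelmer, §1.2.2 (PDF p. 5)] -/
theorem isCyclicKolyvaginLevel_5_5921 :
    haveI := isGloballyMinimal_c944e1; haveI := Fact.mk (by norm_num : Nat.Prime 5);
    IsCyclicKolyvaginLevel ((⟨0, 0, 0, -19, 34⟩ : WeierstrassCurve ℤ).map (Int.castRingHom ℚ)) 5 5921 := by
  haveI := isElliptic_c944e1
  haveI := isGloballyMinimal_c944e1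
  haveI := Fact.mk (by norm_num : Nat.Prime 5)
  haveI : Fact (Nat.Prime 31) := ⟨by norm_num⟩
  haveI : Fact (Nat.Prime 191) := ⟨by norm_num⟩
  have h₁ : Kato.IsKolyvaginPrime ((⟨0, 0, 0, -19, 34⟩ : WeierstrassCurve ℤ).map (Int.castRingHom ℚ)) 5 1 31 :=
    isKolyvaginPrime_of_intModel_of_card intModel 5 1 31 (by norm_num) (by decide +kernel) (by decide) card_31
      (by norm_num)
  have h₂ : Kato.IsKolyvaginPrime ((⟨0, 0, 0, -19, 34⟩ : WeierstrassCurve ℤ).map (Int.castRingHom ℚ)) 5 1 191 :=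
    isKolyvaginPrime_of_intModel_of_card intModel 5 1 191 (by norm_num) (by decide +kernel) (by decide) card_191
      (by norm_num)
  refine ⟨by simpa using isKolyvaginProduct_mul h₁ h₂ (by norm_num), fun ℓ hℓ hdvd ↦ ?_⟩
  rw [show (5921 : ℕ) = 31 * 191 from rfl] at hdvd
  rcases (Nat.Prime.dvd_mul hℓ.out).mp hdvd with h | h
  · obtain rfl := (Nat.prime_dvd_prime_iff_eq hℓ.out (by norm_num)).mp h
    exact card_torsion_le_of_intModel_of_card intModel 5 31 card_31 (by norm_num)
  · obtain rfl := (Nat.prime_dvd_prime_iff_eq hℓ.out (by norm_num)).mp h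
    exact card_torsion_le_of_intModel_of_card intModel 5 191 card_191 (by norm_num)

/-- **`5` is non-anomalous for `944e1`**: `a_5 = 6 − 9 = -3`, `5 ∤ a_5 − 1`. [cite: SilvermanAEC2009, VII.3 Prop. 3.1] -/
theorem nonAnomalous_5 :
    haveI := isGloballyMinimal_c944e1; haveI := Fact.mk (by norm_num : Nat.Prime 5);
    ¬ ((5 : ℕ) : ℤ) ∣ ((⟨0, 0, 0, -19, 34⟩ : WeierstrassCurve ℤ).map (Int.castRingHom ℚ)).frobeniusTrace 5 - 1 := by
  haveI := isElliptic_c944e1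
  haveI := isGloballyMinimal_c944e1
  haveI := Fact.mk (by norm_num : Nat.Prime 5)
  rw [IntModel.frobeniusTrace_eq intModel card_5]
  decide

/-- **`Ш(944e1/ℚ)[5] = 0` FROM THE TREE RECORD `cert_944e1` @ `(5, 31·191)`** (Kurihara currency; replaces the Stein–Wuthrich
input `sha_inf_torsionBy_five_eq_bot hSW` of the v13–v16 rows of this curve): granted Kim 2026 Thm. 1.11 (`hKim`), modularity
(`hnf`), Mazur 1978 Cor. 4.1 (`hMaz`) BY NAME and the record's CLAIM `hδ` (read at level `N_E` through
`KuriharaCertificates.Record.Claim`), `#Sel_5(E/ℚ) ≤ 5² = 5^rank` and so `Ш(E/ℚ)[5] = 0` (`5` good ordinary `goodOrdinary_5`,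
`ρ̄_{E,5}` onto `hasSurjectiveModNGaloisRep_pow_5 1`, `nonAnomalous_5`, Kodaira–Néron `kodairaNeron_of_five_le 5`, `2 ≤ rank`
`KernelCerts002.C944e1.two_le_rank`). CONDITIONAL on the three named facts and the claim; per curve; BSD is not proved by it.
[cite: Kim2022StructureSelmer, Thm. 1.11 (PDF p. 8)] [cite: Mazur1978, Cor. 4.1] [cite: CremonaAlgorithms1997, Table 1 (944e1)] -/
theorem sha_inf_torsionBy_five_eq_bot_of_kuriharaClaim
    (hKim : Kim2022_card_selmerGroup_le_pow_of_kuriharaNumber_ne_zero)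
    (hnf : exists_isNewformOf) (hMaz : mazur_not_dvd_maninConstant_of_odd)
    (hδ : haveI := isElliptic_c944e1; haveI := isGloballyMinimal_c944e1;
      haveI : NeZero (((⟨0, 0, 0, -19, 34⟩ : WeierstrassCurve ℤ).map (Int.castRingHom ℚ)).conductorNorm ℤ) := neZero_conductorNorm_of_isElliptic _;
      haveI := Fact.mk (by norm_num : Nat.Prime 5);
      ∀ (D : ModularParametrizationData ((⟨0, 0, 0, -19, 34⟩ : WeierstrassCurve ℤ).map (Int.castRingHom ℚ)) (((⟨0, 0, 0, -19, 34⟩ : WeierstrassCurve ℤ).map (Int.castRingHom ℚ)).conductorNorm ℤ)), ¬ ((5 : ℕ) : ℤ) ∣ D.maninConstant →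
        (∃ u : ℚ, ‖(u : ℚ_[5])‖ = 1 ∧ ((⟨0, 0, 0, -19, 34⟩ : WeierstrassCurve ℤ).map (Int.castRingHom ℚ)).realPeriodRat = u * plusPeriod D.f) →
        ∃ ψ : (ℓ : ℕ) → (ZMod ℓ)ˣ →* Multiplicative (ZMod 5),
          (∀ ℓ ∈ (5921 : ℕ).primeFactors, Function.Surjective (ψ ℓ)) ∧ kuriharaNumber D.f 5 5921 ψ ≠ 0) :
    haveI := isElliptic_c944e1; haveI := isGloballyMinimal_c944e1; haveI := Fact.mk (by norm_num : Nat.Prime 5);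
    (((⟨0, 0, 0, -19, 34⟩ : WeierstrassCurve ℤ).map (Int.castRingHom ℚ)).sha ⊓ AddSubgroup.torsionBy ((⟨0, 0, 0, -19, 34⟩ : WeierstrassCurve ℤ).map (Int.castRingHom ℚ)).galH1 ((5 : ℕ) : ℤ) : AddSubgroup _) = ⊥ := by
  haveI := isElliptic_c944e1
  haveI := isGloballyMinimal_c944e1
  haveI iNZ : NeZero (((⟨0, 0, 0, -19, 34⟩ : WeierstrassCurve ℤ).map (Int.castRingHom ℚ)).conductorNorm ℤ) := neZero_conductorNorm_of_isElliptic _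
  haveI := Fact.mk (by norm_num : Nat.Prime 5)
  haveI : NeZero (5921 : ℕ) := ⟨by norm_num⟩
  have hsur : ((⟨0, 0, 0, -19, 34⟩ : WeierstrassCurve ℤ).map (Int.castRingHom ℚ)).HasSurjectiveModNGaloisRep (5 ^ 1 : ℕ) := hasSurjectiveModNGaloisRep_pow_5 1
  rw [pow_one] at hsur
  have hν : (5921 : ℕ).primeFactors.card ≤ ((⟨0, 0, 0, -19, 34⟩ : WeierstrassCurve ℤ).map (Int.castRingHom ℚ)).mordellWeilRank := by
    refine le_trans (le_of_eq ?_) KernelCerts002.C944e1.two_le_rank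
    rw [show (5921 : ℕ) = 31 * 191 from rfl, Nat.primeFactors_mul (by norm_num) (by norm_num),
      Nat.Prime.primeFactors (by norm_num), Nat.Prime.primeFactors (by norm_num)]
    decide
  exact sha_inf_torsionBy_eq_bot_of_kuriharaClaim hKim hnf hMaz _ 5 le_rfl goodOrdinary_5.1 goodOrdinary_5.2 hsur
    nonAnomalous_5 (kodairaNeron_of_five_le 5 le_rfl) 5921 isCyclicKolyvaginLevel_5_5921 hν hδ

end C944e1

end Summit.BirchSwinnertonDyer.BirchSwinnertonDyer.Theorems.KolyvaginDepthDoor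

end
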